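import Summits.QuantumAdvantage.QuantumAdvantage.Theorems.WalkNoPerfectLinSelCore
import HarnessLib

/-!
# The char-2 killing method for `k`-form strategies — core (planner qa-qnc0-p2 g23, ROUND-23 §6; part 3a, after
# `WalkNoPerfectLinSelCore` / `WalkNoPerfectLinSel`)

§12 packages the killing step of part 1 once for an ARBITRARY finite family of cube characters with coordinates `ω^x ζ^y`, `y ∈ {1,2}`
(`hits_exists'`, `generic_kill`: such a family cannot sum to `1` identically on `{0,1}^m` once `#T·(2p−1)^m < (2p)^m`).
§13 is the Fourier expansion on `(ZMod p)^k` of a `k`-FORM strategy (cut `g` decides by an arbitrary table `F g` of `k` linear forms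
`mod p`): `[F_g(x(u))] = Σ_a F̂_g(a) ω^{a·x(u)}`, `F̂_g(a) = Σ_v [F_g v] ω^{−a·v}` (`vecIndicator_eq_sum`, `indicatorK_eq_sum`), and
`ω^{a·x(u)} = ∏_i (ω^{Σ_j a_j λ_{g,j,i}})^{u_i}` (`chi_kForm_eq`); so the fire count is a `2p^k·#G`-term sum of such characters
(`card_fire_eq_WsumK`) and `abstract_even_existsK` follows from `generic_kill`.  Consequences (Theorem A′, `NoPerfectFinState2 p n₀` for
every prime `p ≥ 5`) are in part 3b `WalkNoPerfectKForm.lean`.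
-/

open Finset

namespace Summit.QuantumAdvantage.AdviceFreeQNC0

namespace Coset21

namespace CharTwoKill

/-! ### §12 The killing step for an arbitrary finite family of coloured characters -/

section Generic

variable {p : ℕ} [Fact p.Prime] {K : Type*} [Field K] [CharP K 2] {m : ℕ}
variable (ω ζ : K) (hω : IsPrimitiveRoot ω p)
variable {T : Type*} [Fintype T] (cf : T → K) (col : T → Fin m → ZMod p × ℕ)

omit [Fact p.Prime] [CharP K 2] in
/-- double counting: if `#T·(|V|−1)^m < |V|^m` some colouring `γ' ∈ V^m` hits every term. -/
theorem hits_exists' (V : Finset (ZMod p × ℕ)) (hV : ∀ t i, col t i ∈ V)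
    (hcount : Fintype.card T * (V.card - 1) ^ m < V.card ^ m) :
    ∃ γ' : Fin m → ZMod p × ℕ, (∀ i, γ' i ∈ V) ∧ ∀ t : T, ∃ i, γ' i = col t i := by
  classical
  by_contra hno
  push Not at hno
  set P := Fintype.piFinset (fun _ : Fin m => V) with hP
  have hPcard : P.card = V.card ^ m := Fintype.card_piFinset_const V m
  have hmemP : ∀ γ' ∈ P, ∀ i, γ' i ∈ V := fun γ' h i => by
    rw [hP, Fintype.mem_piFinset] at h
    exact h i
  have key : P.card ≤ Fintype.card T * (V.card - 1) ^ m := by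
    calc P.card = ∑ γ' ∈ P, 1 := card_eq_sum_ones _
      _ ≤ ∑ γ' ∈ P, (univ.filter fun t : T => ∀ i, γ' i ≠ col t i).card := by
          refine sum_le_sum fun γ' hγ' => ?_
          rw [Nat.one_le_iff_ne_zero, Ne, card_eq_zero, ← Ne, ← nonempty_iff_ne_empty]
          obtain ⟨t, ht⟩ := hno γ' (hmemP γ' hγ')
          exact ⟨t, by simp [ht]⟩
      _ = ∑ γ' ∈ P, ∑ t : T, (if (∀ i, γ' i ≠ col t i) then 1 else 0) := by
          simp_rw [card_filter]
      _ = ∑ t : T, ∑ γ' ∈ P, (if (∀ i, γ' i ≠ col t i) then 1 else 0) := sum_comm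
      _ = ∑ t : T, (P.filter fun γ' => ∀ i, γ' i ≠ col t i).card := by
          simp_rw [card_filter]
      _ = ∑ t : T, (V.card - 1) ^ m := by
          refine sum_congr rfl fun t _ => ?_
          have hfe : P.filter (fun γ' => ∀ i, γ' i ≠ col t i)
              = Fintype.piFinset (fun i => V.erase (col t i)) := by
            ext γ'
            simp only [mem_filter, hP, Fintype.mem_piFinset, mem_erase]
            constructor
            · rintro ⟨h1, h2⟩ i; exact ⟨h2 i, h1 i⟩
            · intro h; exact ⟨fun i => (h i).2, fun i => (h i).1⟩
          rw [hfe, Fintype.card_piFinset]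
          rw [prod_congr rfl fun i _ => card_erase_of_mem (hV t i)]
          simp
      _ = Fintype.card T * (V.card - 1) ^ m := by rw [sum_const, smul_eq_mul, card_univ]
  rw [hPcard] at key
  exact absurd hcount (not_lt.mpr key)

include hω in
/-- **Generic killing theorem.** A sum of `#T` cube characters with coordinates `ω^x ζ^y` (`y ∈ {1,2}`) cannot be identically `1`
on `{0,1}^m` once `#T·(2p−1)^m < (2p)^m`. -/
theorem generic_kill (hp5 : 5 ≤ p) (hζ : IsPrimitiveRoot ζ 3)
    (hcol : ∀ t i, col t i ∈ (univ : Finset (ZMod p)) ×ˢ ({1, 2} : Finset ℕ))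
    (hcount : Fintype.card T * (2 * p - 1) ^ m < (2 * p) ^ m)
    (hW : ∀ u : Fin m → Bool, ∑ t, cf t * cubeChar (fun i => gam ω ζ hω (col t i)) u = 1) : False := by
  classical
  set V : Finset (ZMod p × ℕ) := (univ : Finset (ZMod p)) ×ˢ ({1, 2} : Finset ℕ) with hVdef
  have hVcard : V.card = 2 * p := by
    rw [hVdef, card_product, card_univ, ZMod.card]
    simp
    ring
  have hcount' : Fintype.card T * (V.card - 1) ^ m < V.card ^ m := by rw [hVcard]; exact hcount
  obtain ⟨γ', hγV, hhit⟩ := hits_exists' col V hcol hcount'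
  have hγ2 : ∀ i, (γ' i).2 % 3 ≠ 0 := by
    intro i
    have := hγV i
    rw [hVdef, mem_product] at this
    rcases this with ⟨-, h2⟩
    simp only [mem_insert, mem_singleton] at h2
    rcases h2 with h2 | h2 <;> omega
  -- Φ_γ of the sum vanishes: every term has a killed coordinate
  have hzero : Phi (fun i => gam ω ζ hω (γ' i))
      (fun u => ∑ t, cf t * cubeChar (fun i => gam ω ζ hω (col t i)) u) = 0 := by
    rw [show (fun u => ∑ t, cf t * cubeChar (fun i => gam ω ζ hω (col t i)) u)
        = (fun u => ∑ t ∈ univ, (fun t u => cf t * cubeChar (fun i => gam ω ζ hω (col t i)) u) t u) from rfl,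
      Phi_sum]
    refine sum_eq_zero fun t _ => ?_
    rw [Phi_cubeChar]
    obtain ⟨i, hi⟩ := hhit t
    apply mul_eq_zero_of_right
    apply prod_eq_zero (mem_univ i)
    rw [← hi, CharTwo.add_self_eq_zero]
  -- but Φ_γ(1) ≠ 0
  have hfun : (fun u => ∑ t, cf t * cubeChar (fun i => gam ω ζ hω (col t i)) u) = fun _ => (1 : K) := funext hW
  rw [hfun, Phi_one] at hzero
  exact (prod_ne_zero_iff.mpr fun i _ => one_add_gam_ne_zero ω ζ hω hp5 hζ (γ' i) (hγ2 i)) hzero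

end Generic

/-! ### §13 `k`-form strategies: the Fourier expansion on `(ZMod p)^k` -/

section KForm

variable {p : ℕ} [Fact p.Prime] {K : Type*} [Field K] [CharP K 2]
variable {G : Type*} [Fintype G] {m k : ℕ}
variable (ω ζ : K) (hω : IsPrimitiveRoot ω p)
variable (lam : G → Fin k → Fin m → ZMod p) (F : G → (Fin k → ZMod p) → Bool) (κ : G → ℕ) (w : G → Fin m → ℕ)

/-- the `k` linear forms of cut `g` evaluated at `u` -/
def kForm (g : G) (u : Fin m → Bool) : Fin k → ZMod p := fun j => ∑ i, if u i = true then lam g j i else 0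

/-- terms `(g, a, b)`: cut, frequency VECTOR `a ∈ 𝔽_p^k`, cube-root exponent `b+1` -/
abbrev TermK (p : ℕ) (G : Type*) (k : ℕ) := G × (Fin k → ZMod p) × Fin 2

/-- coordinate `i` of the character of term `(g,a,b)`: `ω^{Σ_j a_j λ_{g,j,i}} ζ^{(b+1) w_{g,i}}` -/
noncomputable def zvalK (t : TermK p G k) (i : Fin m) : K :=
  chi ω hω (∑ j, t.2.1 j * lam t.1 j i) * ζ ^ ((t.2.2.val + 1) * w t.1 i)

/-- the Fourier coefficient `F̂_g(a) = Σ_v [F_g v] ω^{−a·v}` -/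
noncomputable def Fhat (g : G) (a : Fin k → ZMod p) : K :=
  ∑ v : Fin k → ZMod p, if F g v = true then chi ω hω (-(∑ j, a j * v j)) else 0

/-- the scalar coefficient of term `(g,a,b)` -/
noncomputable def coefK (t : TermK p G k) : K := Fhat ω hω F t.1 t.2.1 * ζ ^ ((t.2.2.val + 1) * κ t.1)

/-- the `K`-valued expansion of the fire count of a `k`-form strategy -/
noncomputable def WsumK (u : Fin m → Bool) : K :=
  ∑ t : TermK p G k, coefK ω ζ hω F κ t * cubeChar (zvalK ω ζ hω lam w t) u

/-- the colour of term `(g,a,b)` at coordinate `i` -/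
def colourK (t : TermK p G k) (i : Fin m) : ZMod p × ℕ := (∑ j, t.2.1 j * lam t.1 j i, ((t.2.2.val + 1) * w t.1 i) % 3)

omit [Fintype G] in
/-- vector orthogonality on `𝔽_p^k`: `Σ_a ω^{a·d} = [d = 0]`. -/
theorem vecIndicator_eq_sum (hp5 : 5 ≤ p) (d : Fin k → ZMod p) :
    (if d = 0 then (1 : K) else 0) = ∑ a : Fin k → ZMod p, chi ω hω (∑ j, a j * d j) := by
  classical
  have hprod : (∏ j : Fin k, (if d j = 0 then (1 : K) else 0)) = if d = 0 then 1 else 0 := by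
    split_ifs with hd
    · exact prod_eq_one fun j _ => by simp [hd]
    · obtain ⟨j, hj⟩ : ∃ j, d j ≠ 0 := by
        by_contra hall
        push Not at hall
        exact hd (funext hall)
      exact prod_eq_zero (mem_univ j) (by simp [hj])
  rw [← hprod]
  have hj : ∀ j : Fin k, (if d j = 0 then (1 : K) else 0) = ∑ a : ZMod p, chi ω hω (a * d j) := fun j => by
    unfold chi; exact indicator_eq_sum hp5 hω (d j)
  simp_rw [hj]
  have := Finset.prod_univ_sum (fun _ : Fin k => (univ : Finset (ZMod p))) (fun j a => chi ω hω (a * d j))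
  rw [Fintype.piFinset_univ] at this
  rw [this]
  refine sum_congr rfl fun a _ => ?_
  rw [addChar_map_sum]

omit [CharP K 2] [Fintype G] in
/-- the character of a frequency vector factors over the coordinates of `u` -/
theorem chi_kForm_eq (g : G) (a : Fin k → ZMod p) (u : Fin m → Bool) :
    chi ω hω (∑ j, a j * kForm lam g u j) = cubeChar (fun i => chi ω hω (∑ j, a j * lam g j i)) u := by
  have hswap : (∑ j, a j * kForm lam g u j) = ∑ i, (if u i = true then ∑ j, a j * lam g j i else 0) := by
    unfold kForm
    simp_rw [Finset.mul_sum]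
    rw [Finset.sum_comm]
    refine sum_congr rfl fun i _ => ?_
    split_ifs <;> simp
  rw [hswap, addChar_map_sum]
  unfold cubeChar
  refine prod_congr rfl fun i _ => ?_
  split_ifs <;> simp [AddChar.map_zero_eq_one]

omit [Fintype G] in
/-- Fourier inversion for the table: `[F_g(x(u))] = Σ_a F̂_g(a) ω^{a·x(u)}` -/
theorem indicatorK_eq_sum (hp5 : 5 ≤ p) (g : G) (u : Fin m → Bool) :
    (if F g (kForm lam g u) = true then (1 : K) else 0)
      = ∑ a : Fin k → ZMod p, Fhat ω hω F g a * chi ω hω (∑ j, a j * kForm lam g u j) := by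
  classical
  set x := kForm lam g u with hx
  have h1 : (if F g x = true then (1 : K) else 0)
      = ∑ v : Fin k → ZMod p, (if F g v = true then (1 : K) else 0) * (if x - v = 0 then 1 else 0) := by
    rw [Finset.sum_eq_single x]
    · simp
    · intro v _ hv
      have : x - v ≠ 0 := sub_ne_zero.mpr (Ne.symm hv)
      simp [this]
    · intro h; exact absurd (mem_univ x) h
  calc (if F g x = true then (1 : K) else 0)
      = ∑ v : Fin k → ZMod p, (if F g v = true then (1 : K) else 0) * (if x - v = 0 then 1 else 0) := h1
    _ = ∑ v : Fin k → ZMod p, (if F g v = true then (1 : K) else 0)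
          * ∑ a : Fin k → ZMod p, chi ω hω (∑ j, a j * (x - v) j) := by
        refine sum_congr rfl fun v _ => ?_
        rw [vecIndicator_eq_sum ω hω hp5 (x - v)]
    _ = ∑ v : Fin k → ZMod p, ∑ a : Fin k → ZMod p,
          (if F g v = true then (1 : K) else 0) * chi ω hω (∑ j, a j * (x - v) j) := by
        simp_rw [Finset.mul_sum]
    _ = ∑ a : Fin k → ZMod p, ∑ v : Fin k → ZMod p,
          (if F g v = true then (1 : K) else 0) * chi ω hω (∑ j, a j * (x - v) j) := Finset.sum_comm
    _ = ∑ a : Fin k → ZMod p, Fhat ω hω F g a * chi ω hω (∑ j, a j * x j) := by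
        refine sum_congr rfl fun a _ => ?_
        unfold Fhat
        rw [Finset.sum_mul]
        refine sum_congr rfl fun v _ => ?_
        by_cases hv : F g v = true
        · simp only [hv, if_true, one_mul]
          rw [← AddChar.map_add_eq_mul]
          congr 1
          simp only [Pi.sub_apply, mul_sub, Finset.sum_sub_distrib]
          ring
        · simp [hv]

omit [CharP K 2] [Fintype G] in
/-- one term: `F̂_g(a) ω^{a·x(u)} ζ^{(b+1)T} = coefK · χ_z(u)` -/
theorem termK_eq (g : G) (a : Fin k → ZMod p) (b : Fin 2) (u : Fin m → Bool) :
    Fhat ω hω F g a * chi ω hω (∑ j, a j * kForm lam g u j) * ζ ^ ((b.val + 1) * (κ g + wForm w g u))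
      = coefK ω ζ hω F κ (g, a, b) * cubeChar (zvalK ω ζ hω lam w (g, a, b)) u := by
  have h2 : ζ ^ ((b.val + 1) * (κ g + wForm w g u))
      = ζ ^ ((b.val + 1) * κ g) * ∏ i, (if u i = true then ζ ^ ((b.val + 1) * w g i) else 1) := by
    unfold wForm
    rw [mul_add, pow_add, Finset.mul_sum, ← prod_pow_eq_pow_sum]
    congr 1
    refine prod_congr rfl fun i _ => ?_
    split_ifs <;> simp
  rw [chi_kForm_eq, h2]
  unfold coefK cubeChar zvalK
  simp only
  rw [mul_assoc, mul_assoc, mul_left_comm (∏ i, _) (ζ ^ _), ← prod_mul_distrib]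
  congr 2
  refine prod_congr rfl fun i _ => ?_
  split_ifs <;> simp

/-- **The expansion** of the fire count of a `k`-form strategy, in `K`. -/
theorem card_fire_eq_WsumK [DecidableEq G] (hp5 : 5 ≤ p) (hζ : IsPrimitiveRoot ζ 3) (u : Fin m → Bool) :
    (((univ.filter fun g : G => F g (kForm lam g u) = true ∧ (κ g + wForm w g u) % 3 ≠ 0).card : ℕ) : K)
      = WsumK ω ζ hω lam F κ w u := by
  classical
  rw [natCast_card_filter]
  unfold WsumK
  rw [Fintype.sum_prod_type]
  refine sum_congr rfl fun g _ => ?_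
  rw [Fintype.sum_prod_type]
  have hind : (if (F g (kForm lam g u) = true ∧ (κ g + wForm w g u) % 3 ≠ 0) then (1 : K) else 0)
      = (if F g (kForm lam g u) = true then (1 : K) else 0) * (if (κ g + wForm w g u) % 3 ≠ 0 then (1 : K) else 0) := by
    rw [ite_zero_mul_ite_zero, one_mul]
  rw [hind, indicatorK_eq_sum ω hω lam F hp5, live_eq hζ, Finset.sum_mul]
  refine sum_congr rfl fun a _ => ?_
  rw [Fin.sum_univ_two, ← termK_eq, ← termK_eq, mul_add]
  congr 3; simp

omit [Fintype G] in
/-- every colour lies in `𝔽_p × {1,2}` -/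
theorem colourK_mem (hw : ∀ g i, w g i = 1 ∨ w g i = 2) (t : TermK p G k) (i : Fin m) :
    colourK lam w t i ∈ (univ : Finset (ZMod p)) ×ˢ ({1, 2} : Finset ℕ) := by
  rw [mem_product]
  refine ⟨mem_univ _, ?_⟩
  simp only [colourK, mem_insert, mem_singleton]
  have hb : t.2.2.val = 0 ∨ t.2.2.val = 1 := by have := t.2.2.isLt; omega
  rcases hw t.1 i with h | h <;> rcases hb with hb | hb <;> simp [h, hb]

omit [CharP K 2] [Fintype G] in
/-- the coordinates of a term character are `gam` of its colours -/
theorem zvalK_eq_gam (hζ : IsPrimitiveRoot ζ 3) (t : TermK p G k) (i : Fin m) :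
    zvalK ω ζ hω lam w t i = gam ω ζ hω (colourK lam w t i) := by
  unfold zvalK gam colourK
  simp only
  congr 1
  conv_lhs => rw [← Nat.mod_add_div ((t.2.2.val + 1) * w t.1 i) 3, pow_add, pow_mul, hζ.pow_eq_one,
    one_pow, mul_one]

/-- the number of terms is `#G · p^k · 2` -/
theorem card_TermK : Fintype.card (TermK p G k) = Fintype.card G * (p ^ k * 2) := by
  simp only [TermK, Fintype.card_prod, Fintype.card_fun, ZMod.card, Fintype.card_fin]

include ω hω in
/-- **Abstract no-perfect theorem for `k`-form strategies.** -/
theorem abstract_even_existsK [DecidableEq G] (hp5 : 5 ≤ p) (hζ : IsPrimitiveRoot ζ 3)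
    (hw : ∀ g i, w g i = 1 ∨ w g i = 2)
    (hcount : Fintype.card G * (p ^ k * 2) * (2 * p - 1) ^ m < (2 * p) ^ m) :
    ∃ u : Fin m → Bool,
      (univ.filter fun g : G => F g (kForm lam g u) = true ∧ (κ g + wForm w g u) % 3 ≠ 0).card % 2 = 0 := by
  classical
  by_contra hall
  push Not at hall
  have hW : ∀ u, WsumK ω ζ hω lam F κ w u = 1 := by
    intro u
    rw [← card_fire_eq_WsumK ω ζ hω lam F κ w hp5 hζ u]
    have hodd : (univ.filter fun g : G => F g (kForm lam g u) = true ∧ (κ g + wForm w g u) % 3 ≠ 0).card % 2 = 1 := by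
      have := hall u; omega
    rw [CharP.cast_eq_mod K 2, hodd, Nat.cast_one]
  have hW' : ∀ u, ∑ t : TermK p G k, coefK ω ζ hω F κ t * cubeChar (fun i => gam ω ζ hω (colourK lam w t i)) u = 1 := by
    intro u
    rw [← hW u]
    unfold WsumK
    refine sum_congr rfl fun t _ => ?_
    congr 2
    funext i
    rw [zvalK_eq_gam ω ζ hω lam w hζ]
  refine generic_kill ω ζ hω (coefK ω ζ hω F κ) (colourK lam w) hp5 hζ (colourK_mem lam w hw) ?_ hW'
  rw [card_TermK]; exact hcount

end KForm

end CharTwoKill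

end Coset21

end Summit.QuantumAdvantage.AdviceFreeQNC0
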